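import Summits.ABC.IUTFork.LDHGenuinePerImageSufficiencyPoint
import HarnessLib

/-!
# The fork at [IUTchIII] Corollary 3.12, L-DH level: the NUMBER-level Corollary `T.Cor312Of` (reading (U), the binder `hNum` of branch C's
# certificate of record `abc_of_SH_v10K_window`) is a THEOREM at every Szpiro-good datum — so `hNum` CUTS to the Szpiro-bad deep data

Record-only PROOF file (D-0012) of the abc-iut cell (WAVE-3 discharge seat abc-iut-c312-d1, gen 7; row «P-CRUX-SUFFICIENCY», part G);
TAKES NO SIDE on [IUTchIII] Cor. 3.12 or on the (U)/(P) readings. Branch C's certificate of record (abc-iut-C-cert-3 p447945,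
`Conditional.abc_of_SH_v10K_window`; C lead C-R24) has explicit 3 = `hSHw` (the (xi-f) licence in the undecided window) · `hNum` (the
NUMBER-level Corollary `T.Cor312Of` at the DEEP admissible data, where the licence is refuted) · `hreg`. Part B of this row
(`Cor22.ThetaVolumeDatumAt.cor312PerImageOf_of_le_logDiff_logCond`, p446147) proves the STRONGER per-image Corollary at every datum of a
Szpiro-good `(P, l)`; reading (P) implies reading (U) (`DHData.cor312Of_of_cor312PerImageOf`, this lineage p421164/p425589). Hence:

* `Cor22.ThetaVolumeDatumAt.cor312Of_of_le_logDiff_logCond` / `…cor312Of_of_szpiro` — per datum `T` at `(P, l)` (`λ ∈ U_X`, `d_mod ≤ (l+5)/4`):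
  `κ_l·log q^{∤2l}(λ) ≤ ((l+5)/4 − d_mod)·(log-diff + (1 − 1/l)·log 𝔣^{∤2l}) + ((l+5)/4)·log π` (resp. its Szpiro form, `l ≥ 5`) ⟹ **`T.Cor312Of`**;
* `Cor22.cor312AtDatum_of_szpiro` — the (U)-crux `Cor22.Cor312AtDatum P l` at every Szpiro-good `(P, l)`;
* **`Cor22.forall_cor312Of_of_szpiroBad`** — the CUT SCHEMA for certificate writers: for ANY per-datum predicate `Φ` (e.g. the depth locus
  `DeepOrd`) and `l ≥ 5`, «`T.Cor312Of` at every `T` with `Φ T`» FOLLOWS from «`T.Cor312Of` at every `T` with `Φ T`, PROVIDED `(P, l)` is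
  Szpiro-bad: `(l+5)/4 < d_mod ∨ (6l(l+5−4d_mod)/((l+4)(l−3)))·(log-diff + (1−1/l)·log-cond) + (6l(l+5)/((l+4)(l−3)))·log π < log q^{∤2l}`» —
  i.e. the binder `hNum` of `abc_of_SH_v10K_window` may be restricted to the Szpiro-BAD deep data with no other change (a weakening, C-R2).

READING (numbers; no side): after this cut the live number-level input of branch C sits exactly on «deep ∧ Szpiro ratio ≳ 6(1 − O(1/l))» — the
abc locus. Nothing here asserts `Cor312Of` for any datum or the existence of data; typed ≠ proved; proved-as-typed ≠ in print.
[cite: Mochizuki2012, IUTchIII Cor. 3.12 p. 173–174; IUTchIV Thm. 1.10 p. 22–23, Cor. 2.2 (ii) proof p. 46] [claim: Mochizuki2012, status: disputed]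
-/

noncomputable section

namespace Literature.IUT.LogVolume.Cor22

open Literature.NumberTheory.DiophantineGeometry.GenEll Summit.ABC.IUTFork Literature.IUT.HodgeTheaters

namespace ThetaVolumeDatumAt

variable {P : NFPoint} {l : ℕ} (T : ThetaVolumeDatumAt P l)

/-- **The NUMBER-level Corollary (reading (U)) at a Szpiro-good datum**: `λ ∈ U_X`, `l ≥ 1`, `d_mod ≤ (l+5)/4`,
`κ_l·log q^{∤2l} ≤ ((l+5)/4 − d_mod)·(log-diff + (1 − 1/l)·log-cond) + ((l+5)/4)·log π ⟹ T.Cor312Of` (part B's per-image form, then (P) ⟹ (U)).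
[cite: Mochizuki2012, IUTchIII Cor. 3.12 p. 173–174] [claim: Mochizuki2012, status: disputed] -/
theorem cor312Of_of_le_logDiff_logCond (hU : P.InU) (hl : 0 < l)
    (hd : (dmod P : ℝ) ≤ ((l : ℝ) + 5) / 4)
    (h : (((l : ℝ) + 1) / 24 - 1 / (2 * l)) * logQAvoid P {2, l} ≤
      (((l : ℝ) + 5) / 4 - dmod P) * (P.logDiff + (1 - 1 / (l : ℝ)) * logCondAvoid P {2, l})
        + ThetaVolumeInput.archLogTheta l) :
    T.Cor312Of := by
  letI := T.instFieldF; letI := T.instNumberFieldF; letI := T.instAlgebraF; letI := T.instFieldK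
  letI := T.instNumberFieldK; letI := T.instAlgebraK; letI := T.instFieldFbar; letI := T.instAlgebraFbar
  letI := T.instAlgebraKFbar; letI := T.instIsElliptic
  exact DHData.cor312Of_of_cor312PerImageOf T.I (T.cor312PerImageOf_of_le_logDiff_logCond hU hl hd h)

/-- **The NUMBER-level Corollary at a Szpiro-good datum, Szpiro form** (`l ≥ 5`, `d_mod ≤ (l+5)/4`):
`log q^{∤2l} ≤ (6l(l+5−4d_mod)/((l+4)(l−3)))·(log-diff + (1 − 1/l)·log-cond) + (6l(l+5)/((l+4)(l−3)))·log π ⟹ T.Cor312Of`.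
[cite: Mochizuki2012, IUTchIII Cor. 3.12 p. 173–174] [claim: Mochizuki2012, status: disputed] -/
theorem cor312Of_of_szpiro (hU : P.InU) (h5 : 5 ≤ l)
    (hd : (dmod P : ℝ) ≤ ((l : ℝ) + 5) / 4)
    (h : logQAvoid P {2, l} ≤
      6 * l * (((l : ℝ) + 5) - 4 * dmod P) / (((l : ℝ) + 4) * ((l : ℝ) - 3))
          * (P.logDiff + (1 - 1 / (l : ℝ)) * logCondAvoid P {2, l})
        + 6 * l * ((l : ℝ) + 5) / (((l : ℝ) + 4) * ((l : ℝ) - 3)) * Real.log Real.pi) :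
    T.Cor312Of := by
  letI := T.instFieldF; letI := T.instNumberFieldF; letI := T.instAlgebraF; letI := T.instFieldK
  letI := T.instNumberFieldK; letI := T.instAlgebraK; letI := T.instFieldFbar; letI := T.instAlgebraFbar
  letI := T.instAlgebraKFbar; letI := T.instIsElliptic
  exact DHData.cor312Of_of_cor312PerImageOf T.I (cor312PerImageAtDatum_of_szpiro hU h5 hd h T)

end ThetaVolumeDatumAt

variable {P : NFPoint} {l : ℕ}

/-- **The (U)-line crux at every Szpiro-good `(P, l)`** (`l ≥ 5`, `d_mod ≤ (l+5)/4`): the Szpiro-type bound implies `Cor22.Cor312AtDatum P l`.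
[cite: Mochizuki2012, IUTchIII Cor. 3.12 p. 173–174] [claim: Mochizuki2012, status: disputed] -/
theorem cor312AtDatum_of_szpiro (hU : P.InU) (h5 : 5 ≤ l)
    (hd : (dmod P : ℝ) ≤ ((l : ℝ) + 5) / 4)
    (h : logQAvoid P {2, l} ≤
      6 * l * (((l : ℝ) + 5) - 4 * dmod P) / (((l : ℝ) + 4) * ((l : ℝ) - 3))
          * (P.logDiff + (1 - 1 / (l : ℝ)) * logCondAvoid P {2, l})
        + 6 * l * ((l : ℝ) + 5) / (((l : ℝ) + 4) * ((l : ℝ) - 3)) * Real.log Real.pi) :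
    Cor312AtDatum P l :=
  cor312AtDatum_of_perImage (cor312PerImageAtDatum_of_szpiro hU h5 hd h)

/-- **CUT SCHEMA for the binder `hNum` of branch C's certificate of record** (`abc_of_SH_v10K_window`): for ANY per-datum predicate `Φ` (e.g.
the depth locus) at `λ ∈ U_X`, `l ≥ 5`: if the NUMBER-level Corollary `T.Cor312Of` holds at every `T` with `Φ T` WHENEVER `(P, l)` is Szpiro-BAD
(`(l+5)/4 < d_mod`, or `log q^{∤2l}` above the explicit Szpiro-type bound), then it holds at every `T` with `Φ T` — the Szpiro-good case is the
theorem `cor312Of_of_szpiro`. So `hNum` may be demanded only at the Szpiro-bad deep data. [claim: Mochizuki2012, status: disputed]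
[cite: Mochizuki2012, IUTchIII Cor. 3.12 p. 173–174; IUTchIV Cor. 2.2 (ii) proof p. 46] -/
theorem forall_cor312Of_of_szpiroBad (hU : P.InU) (h5 : 5 ≤ l) (Φ : ThetaVolumeDatumAt P l → Prop)
    (hbad : (((l : ℝ) + 5) / 4 < (dmod P : ℝ) ∨
        6 * l * (((l : ℝ) + 5) - 4 * dmod P) / (((l : ℝ) + 4) * ((l : ℝ) - 3))
            * (P.logDiff + (1 - 1 / (l : ℝ)) * logCondAvoid P {2, l})
          + 6 * l * ((l : ℝ) + 5) / (((l : ℝ) + 4) * ((l : ℝ) - 3)) * Real.log Real.pi < logQAvoid P {2, l}) →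
      ∀ T : ThetaVolumeDatumAt P l, Φ T → T.Cor312Of) :
    ∀ T : ThetaVolumeDatumAt P l, Φ T → T.Cor312Of := by
  intro T hΦ
  by_cases hd : (dmod P : ℝ) ≤ ((l : ℝ) + 5) / 4
  · by_cases hq : logQAvoid P {2, l} ≤
        6 * l * (((l : ℝ) + 5) - 4 * dmod P) / (((l : ℝ) + 4) * ((l : ℝ) - 3))
            * (P.logDiff + (1 - 1 / (l : ℝ)) * logCondAvoid P {2, l})
          + 6 * l * ((l : ℝ) + 5) / (((l : ℝ) + 4) * ((l : ℝ) - 3)) * Real.log Real.pi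
    · exact T.cor312Of_of_szpiro hU h5 hd hq
    · exact hbad (Or.inr (lt_of_not_ge hq)) T hΦ
  · exact hbad (Or.inl (lt_of_not_ge hd)) T hΦ

/-- The same cut for the PER-IMAGE reading (`T.Cor312PerImageOf`, any predicate `Φ`). [claim: Mochizuki2012, status: disputed]
[cite: Mochizuki2012, IUTchIII Cor. 3.12 proof Step (x) p. 181] -/
theorem forall_cor312PerImageOf_of_szpiroBad (hU : P.InU) (h5 : 5 ≤ l) (Φ : ThetaVolumeDatumAt P l → Prop)
    (hbad : (((l : ℝ) + 5) / 4 < (dmod P : ℝ) ∨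
        6 * l * (((l : ℝ) + 5) - 4 * dmod P) / (((l : ℝ) + 4) * ((l : ℝ) - 3))
            * (P.logDiff + (1 - 1 / (l : ℝ)) * logCondAvoid P {2, l})
          + 6 * l * ((l : ℝ) + 5) / (((l : ℝ) + 4) * ((l : ℝ) - 3)) * Real.log Real.pi < logQAvoid P {2, l}) →
      ∀ T : ThetaVolumeDatumAt P l, Φ T → T.Cor312PerImageOf) :
    ∀ T : ThetaVolumeDatumAt P l, Φ T → T.Cor312PerImageOf := by
  intro T hΦ
  by_cases hd : (dmod P : ℝ) ≤ ((l : ℝ) + 5) / 4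
  · by_cases hq : logQAvoid P {2, l} ≤
        6 * l * (((l : ℝ) + 5) - 4 * dmod P) / (((l : ℝ) + 4) * ((l : ℝ) - 3))
            * (P.logDiff + (1 - 1 / (l : ℝ)) * logCondAvoid P {2, l})
          + 6 * l * ((l : ℝ) + 5) / (((l : ℝ) + 4) * ((l : ℝ) - 3)) * Real.log Real.pi
    · exact cor312PerImageAtDatum_of_szpiro hU h5 hd hq T
    · exact hbad (Or.inr (lt_of_not_ge hq)) T hΦ
  · exact hbad (Or.inl (lt_of_not_ge hd)) T hΦ

end Literature.IUT.LogVolume.Cor22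

end
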